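import Summits.QuantumFields.BalabanUV.Beta.D1BFx.GluonNeedleGlue
import Summits.QuantumFields.BalabanUV.Beta.D1BFx.BlockSumTranspose
import Summits.QuantumFields.BalabanUV.Beta.D1BFx.DressedTablesLeg
import Summits.QuantumFields.BalabanUV.Beta.D1BFx.GluonBubbleTails
import Summits.QuantumFields.BalabanUV.Beta.D1BFx.NeedleDipShape
import Summits.QuantumFields.BalabanUV.Beta.D1BFx.FineStencilBFBalaban

/-!
# `BalabanUV.Beta.D1BFx.CellSumTranspose` — road «BF-x» for binder row D1, slot (K), END row `hGrp gN`, «CELLSUM-TRANSPOSE»: THE GLUON NEEDLE CELL IS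
# SYMMETRIC UNDER EXCHANGING THE TWO STENCIL FAMILIES — `cellSum n a S T μ ν = cellSum n a T S ν μ` for block-covariant families bi-localised at
# their bonds (the owner's (S-TRANSP) `BlockSumTranspose.sum_resSite_tsum_transpose` + the bubble's vertex symmetry), with the covariances of the
# transverse Wilson sector `SbT` (all lattice translations) and of the ghost-kinetic dipole `dipPiece` (block translations)

HONEST DEPENDENCY (cell records, verbatim): «continuum YM on T⁴ ⇐ BetaPertH ∧ nine spine estimates (0/9 proved); BetaPertH ⇐ (D1) ∧ (D4) ∧
CAP+tail; G-an2-4 gates asym, D1 and NE2/3/4.»  HONEST FRAMING (cell contract, verbatim): «discharging `BetaPertH` makes Bałaban's UV stability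
UNCONDITIONAL — a real constructive-QFT result; it is NOT the continuum limit and NOT the Clay problem.»  THIS MODULE DISCHARGES NOTHING of the
wall: [folklore] bookkeeping BY NAME over the owner's `BlockSumTranspose.sum_resSite_tsum_transpose` ∕ `tsum_shift_base` (p252875), `GluonNeedleGlue.cellSum`,
`Assembly.sum_image_resSite` ∕ `fullSum_weight_mul_eq_tsum` ∕ `summable_weight_mul_of_absMoment₂`, `FineHessianSectors.absMoment₂_baseKer_biBubbleTable` ∕
`biBubble_shiftK`, `DressedTablesLeg.bubble_comm`, `GluonLeg.shiftK_Ga_neg`; for the covariances leaf-03-g12's `GluonBubbleTails.SbT_eq_realK`, the owner's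
`StencilRealisation.realK`, leaf-04-g9's `NeedleDipShape.dipPiece_eq_dSw_tensor`, `RJetAssembly.dSw_shiftK`, `RJetProjector.shiftK_Pgt`, `GhostLeg.shiftK_Ggh`.
No `def`, no `def … : Prop`, nothing cited, no hypothesis is a printed statement, 0 sorry.  Asserts NO bound on any table of the road.  Root-level binders
hW ∕ hR-sockets ∕ hSX-socket ∕ D1Tel ∕ D1Rep — 0 discharged; (K) NOT closed; NOT D1, NOT `BetaPertH`, NOT continuum, NOT Clay.

ABSOLUTE RULE (cell charter, verbatim): «No internally-minted statement may enter as a cited fact. Every hypothesis is either kernel-proved in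
this package or a verbatim quotation of a PUBLISHED theorem with page reference. The manuscript(s) under audit are NOT citable for their own
disputed steps — they are the thing under adjudication; programme-internal (2001/route/tribunal) claims are never citable.»

WHY (owner d1-p2-g11, journal l.31387 «T₂-K first refusal leaf-03-g13 after GN-K (its summed frame transposes)»; leaf-03-g13 INTENT-B l.31595).  The T₂
pieces (`dip ⊗ SbT`, `proj ⊗ SbT`, `ndl ⊗ SbT`) have the LIST vertex `SbT` fixed at the base and the rank-one partner's CENTRE moving with the (1.22)
variable `w`: the by-parts frame of `LocalVertexByPartsSum` (differences of the ends at a FIXED partner) does not transpose — summation by parts in `w`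
would difference the dipole in its source slot (d2-class).  Instead the two cells are the two READINGS (base pinned to the residue cell vs. running
site pinned) of ONE jointly `n`-periodic two-point function `Φ(u,u′) = biBubbleTable Ga Ga S T μ ν u u′` against the EVEN weight `w_μw_ν`; the owner's
(S-TRANSP) exchanges them, and the bubble's vertex symmetry (`bubble_comm`) turns `Φ(b, b+w)` into the `(T, S, ν, μ)` cell.  Hence every mirror cell
of the gluon needle rows is its partner with `(μ,ν)` swapped: T₂-K∕P∕Q̇ from T₁-K∕P∕Q̇, KP from PK, KN from NK, DP from PD.
* §1 [folklore] `shiftK_add'`∕`shiftK_sub'`, `periodic_biBubbleTable` (joint `n`-periodicity from block covariance), `biBubbleTable_swap` (vertex symmetry),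
  `summable_cell_reading` (both readings absolutely summable), **`cellSum_transpose`**.
* §2 [folklore] the covariances: `elemK_translate`, **`realK_translate`**, **`SbT_translate`** (all `v`), `shiftK_RG`, `RG_translate_source`, `Pgt_translate_row`,
  **`dipPiece_translate_block`** (`dipPiece n a κ (u + n•t) = shiftK (−(n•t)) (dipPiece n a κ u)`), `cornerV_shiftK`∕`cornerJ_shiftK`,
  **`projPiece_translate_block`**, **`ndlPiece_translate_block`** (so every piece of `SbRblk = cK•dip + ndl − proj` is block-covariant: all mirror cells).
NOT HERE (honest): any estimate; the T₂ cells themselves (one-line corollaries in the consumers: `GluonDipLocalRow` for T₂-K).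
Unit `b2b-balaban-beta-d1-formalise-leaf-03` (gen 13), D1 formalisation swarm, road «BF-x»; `LEAVES-BFx.md` row (N) «CELLSUM-TRANSPOSE».
-/

noncomputable section

namespace Summit.QuantumFields.BalabanUV.Beta.D1BFx.CellSumTranspose

open Finset Filter Topology
open scoped BigOperators
open Literature.MathematicalPhysics.QuantumFieldTheory.Balaban1983to89
open Literature.MathematicalPhysics.QuantumFieldTheory.Balaban1983to89.Beta
open ExpKernelCalculus (Site MKer BiLoc bubble shiftK comp comp_shiftK)
open DyadicShell (Pt toReal toReal_apply)
open WindowIdentification (fullSum)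
open DressedMomentNormalisation (resSite)
open DecimatedMomentSummable (AbsMoment₂)
open GradedBubbles (LP Stn)
open Summit.QuantumFields.BalabanUV.Beta.TameKernelCalculus (Spr Loc)
open Summit.QuantumFields.BalabanUV.Beta.D1BFx.PackedKernelSplit (biBubble bubble_eq_biBubble)
open Summit.QuantumFields.BalabanUV.Beta.D1BFx.FineHessianSectors (biBubbleTable biBubbleTable_apply biBubble_shiftK absMoment₂_baseKer_biBubbleTable)
open Summit.QuantumFields.BalabanUV.Beta.D1BFx.ReducedKernel (StencilR)
open Summit.QuantumFields.BalabanUV.Beta.D1BFx.MomentTransferPeriodic (baseKer)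
open Summit.QuantumFields.BalabanUV.Beta.D1BFx.Assembly (sum_image_resSite fullSum_weight_mul_eq_tsum summable_weight_mul_of_absMoment₂)
open Summit.QuantumFields.BalabanUV.Beta.D1BFx.BlockSumTranspose (sum_resSite_tsum_transpose tsum_shift_base)
open Summit.QuantumFields.BalabanUV.Beta.D1BFx.DressedTablesLeg (bubble_comm)
open Summit.QuantumFields.BalabanUV.Beta.D1BFx.GluonLeg (Ga shiftK_Ga_neg)
open Summit.QuantumFields.BalabanUV.Beta.D1BFx.GluonNeedleGlue (cellSum cellSum_def)
open Summit.QuantumFields.BalabanUV.Beta.D1BFx.FiniteStencilCalculus (elemK elemK_apply)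
open Summit.QuantumFields.BalabanUV.Beta.D1BFx.StencilRealisation (realK realK_nil realK_cons)
open Summit.QuantumFields.BalabanUV.Beta.D1BFx.WilsonStencilRealised (reixStn ιU)
open Summit.QuantumFields.BalabanUV.Beta.D1BFx.SectorRecut (SbT)
open Summit.QuantumFields.BalabanUV.Beta.D1BFx.GluonBubbleTails (SbT_eq_realK)
open Summit.QuantumFields.BalabanUV.Beta.D1BFx.RProjector (Pgt)
open Summit.QuantumFields.BalabanUV.Beta.D1BFx.RJetProjector (shiftK_Pgt)
open Summit.QuantumFields.BalabanUV.Beta.D1BFx.GhostLeg (Ggh shiftK_Ggh)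
open Summit.QuantumFields.BalabanUV.Beta.D1BFx.RProjectorJet (RG cornerV cornerJ Jq Jq_translate)
open Summit.QuantumFields.BalabanUV.Beta.D1BFx.GhostStencil (qAnti qAnti_translate)
open Summit.QuantumFields.BalabanUV.Beta.D1BFx.FineStencilBFBalaban (kerP_translate_road)
open Summit.QuantumFields.BalabanUV.Beta.D1BFx.RJetAssembly (dSw dSw_shiftK dJetSw dJetSw_translate)
open Summit.QuantumFields.BalabanUV.Beta.D1BFx.RankOneBubbleJets (tensor tensor_apply)
open Summit.QuantumFields.BalabanUV.Beta.D1BFx.GluonNeedleSplit (dipPiece projPiece ndlPiece projPiece_apply ndlPiece_apply)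
open Summit.QuantumFields.BalabanUV.Beta.D1BFx.NeedleDipShape (dipPiece_eq_dSw_tensor)

/-! ## §1 The transpose of the cell -/

section Transpose

variable (n : ℕ) [NeZero n] (a : ℝ)

omit [NeZero n] in
/-- [folklore] `shiftK` is additive in the kernel. -/
theorem shiftK_add' {F : Type*} (v : Site 4) (K L : MKer 4 F) : shiftK v (K + L) = shiftK v K + shiftK v L := rfl

omit [NeZero n] in
/-- [folklore] `shiftK` respects differences of kernels. -/
theorem shiftK_sub' {F : Type*} (v : Site 4) (K L : MKer 4 F) : shiftK v (K - L) = shiftK v K - shiftK v L := rfl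

/-- [folklore] **JOINT BLOCK PERIODICITY OF THE CELL'S TWO-POINT FUNCTION** from the block covariance of the two families and of the leg:
`biBubbleTable Ga Ga S T μ ν (u + n•t) (u′ + n•t) = biBubbleTable Ga Ga S T μ ν u u′`. -/
theorem periodic_biBubbleTable {S T : StencilR}
    (hSc : ∀ (κ : Fin 4) (u t : Site 4), S κ (u + (n : ℤ) • t) = shiftK (-((n : ℤ) • t)) (S κ u))
    (hTc : ∀ (κ : Fin 4) (u t : Site 4), T κ (u + (n : ℤ) • t) = shiftK (-((n : ℤ) • t)) (T κ u)) (μ ν : Fin 4) (u u' t : Site 4) :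
    biBubbleTable (Ga n a) (Ga n a) S T μ ν (u + (n : ℤ) • t) (u' + (n : ℤ) • t) = biBubbleTable (Ga n a) (Ga n a) S T μ ν u u' := by
  rw [biBubbleTable_apply, biBubbleTable_apply, hSc, hTc]
  conv_lhs => rw [← shiftK_Ga_neg n a NeZero.one_le t]
  rw [biBubble_shiftK]

/-- [folklore] **THE VERTEX SYMMETRY OF THE CELL'S TWO-POINT FUNCTION**: `biBubbleTable Ga Ga S T μ ν u u′ = biBubbleTable Ga Ga T S ν μ u′ u` (spread leg,
localised stencils; `bubble_comm`). -/
theorem biBubbleTable_swap (hA : Spr (Ga n a)) {S T : StencilR} (hS : ∀ κ u, Loc (S κ u)) (hT : ∀ κ u, Loc (T κ u)) (μ ν : Fin 4) (u u' : Site 4) :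
    biBubbleTable (Ga n a) (Ga n a) S T μ ν u u' = biBubbleTable (Ga n a) (Ga n a) T S ν μ u' u := by
  rw [biBubbleTable_apply, biBubbleTable_apply, ← bubble_eq_biBubble, ← bubble_eq_biBubble, bubble_comm hA (hS μ u) (hT ν u')]

/-- [folklore] **BOTH READINGS OF THE CELL ARE ABSOLUTELY SUMMABLE**: for families bi-localised at their bonds uniformly, at every base `b` the weighted
base-point kernel `w ↦ w_μw_ν·biBubbleTable Ga Ga S T κ λ (b + w) b` is summable. -/
theorem summable_cell_reading (hA : Spr (Ga n a)) {S T : StencilR} {Cs δs Ct δt : ℝ} (hS : ∀ κ u, BiLoc (S κ u) u u Cs δs) (hδs : 0 < δs)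
    (hT : ∀ κ u, BiLoc (T κ u) u u Ct δt) (hδt : 0 < δt) (κ lam μ ν : Fin 4) (b : Site 4) :
    Summable fun w : Pt => toReal w μ * toReal w ν * biBubbleTable (Ga n a) (Ga n a) S T κ lam (b + w) b :=
  summable_weight_mul_of_absMoment₂ (absMoment₂_baseKer_biBubbleTable (Ga n a) (Ga n a) hA hA hS hδs hT hδt κ lam b) μ ν

/-- [folklore] **«CELLSUM-TRANSPOSE»: THE GLUON NEEDLE CELL IS SYMMETRIC UNDER EXCHANGING THE TWO FAMILIES** — `cellSum n a S T μ ν = cellSum n a T S ν μ` for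
families bi-localised at their bonds uniformly and block-covariant (period `n`).  Proof: both readings summable; `fullSum = tsum` (the origin carries weight 0);
the owner's (S-TRANSP) for the jointly periodic `Φ = biBubbleTable Ga Ga S T μ ν` and the even weight `w_μw_ν`; the vertex symmetry pointwise. -/
theorem cellSum_transpose (hA : Spr (Ga n a)) {S T : StencilR} {Cs δs Ct δt : ℝ} (hS : ∀ κ u, BiLoc (S κ u) u u Cs δs) (hδs : 0 < δs)
    (hT : ∀ κ u, BiLoc (T κ u) u u Ct δt) (hδt : 0 < δt)
    (hSc : ∀ (κ : Fin 4) (u t : Site 4), S κ (u + (n : ℤ) • t) = shiftK (-((n : ℤ) • t)) (S κ u))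
    (hTc : ∀ (κ : Fin 4) (u t : Site 4), T κ (u + (n : ℤ) • t) = shiftK (-((n : ℤ) • t)) (T κ u)) (μ ν : Fin 4) :
    cellSum n a S T μ ν = cellSum n a T S ν μ := by
  have hSl : ∀ κ u, Loc (S κ u) := fun κ u => ⟨u, u, Cs, δs, hδs, hS κ u⟩
  have hTl : ∀ κ u, Loc (T κ u) := fun κ u => ⟨u, u, Ct, δt, hδt, hT κ u⟩
  set Φ : Site 4 → Site 4 → ℝ := fun u u' => biBubbleTable (Ga n a) (Ga n a) S T μ ν u u' with hΦ
  set p : Pt → ℝ := fun w => toReal w μ * toReal w ν with hp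
  -- both cells as `Σ_r Σ'_w p w · (reading)`
  have hL : cellSum n a S T μ ν = ∑ r : Fin 4 → Fin n, ((n : ℝ) ^ 4)⁻¹ * ∑' w : Pt, p w * Φ (resSite r + w) (resSite r) := by
    rw [cellSum_def, sum_image_resSite]
    refine Finset.sum_congr rfl fun r _ => ?_
    have e := fullSum_weight_mul_eq_tsum (absMoment₂_baseKer_biBubbleTable (Ga n a) (Ga n a) hA hA hS hδs hT hδt μ ν (resSite r)) μ ν
    simp only [baseKer] at e
    rw [e]
    rfl
  have hR : cellSum n a T S ν μ = ∑ r : Fin 4 → Fin n, ((n : ℝ) ^ 4)⁻¹ * ∑' w : Pt, p w * Φ (resSite r) (resSite r + w) := by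
    rw [cellSum_def, sum_image_resSite]
    refine Finset.sum_congr rfl fun r _ => ?_
    have e := fullSum_weight_mul_eq_tsum (absMoment₂_baseKer_biBubbleTable (Ga n a) (Ga n a) hA hA hT hδt hS hδs ν μ (resSite r)) ν μ
    simp only [baseKer] at e
    rw [e]
    congr 1
    refine tsum_congr fun w => ?_
    rw [hp, hΦ]; dsimp only
    rw [toReal_apply, toReal_apply, biBubbleTable_swap n a hA hSl hTl μ ν (resSite r) (resSite r + w)]
    ring
  rw [hL, hR, ← Finset.mul_sum, ← Finset.mul_sum]
  congr 1
  -- the owner's (S-TRANSP), in running-site form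
  have hper : ∀ u v t : Site 4, Φ (u + (n : ℤ) • t) (v + (n : ℤ) • t) = Φ u v := fun u v t => periodic_biBubbleTable n a hSc hTc μ ν u v t
  have hev : ∀ z : Pt, p (-z) = p z := fun z => by simp only [hp, toReal_apply, Pi.neg_apply, Int.cast_neg]; ring
  have hS₁ : ∀ r : Fin 4 → Fin n, Summable fun w => p w * Φ (resSite r + w) (resSite r) := fun r =>
    summable_cell_reading n a hA hS hδs hT hδt μ ν μ ν (resSite r)
  have hS₂ : ∀ r : Fin 4 → Fin n, Summable fun w => p w * Φ (resSite r) (resSite r + w) := fun r => by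
    refine (summable_cell_reading n a hA hT hδt hS hδs ν μ μ ν (resSite r)).congr fun w => ?_
    simp only [hp, hΦ, biBubbleTable_swap n a hA hSl hTl μ ν (resSite r) (resSite r + w)]
  have h := sum_resSite_tsum_transpose (NeZero.pos n) Φ p hper hev hS₁ hS₂
  simp_rw [tsum_shift_base] at h
  exact h

end Transpose

/-! ## §2 The covariances: `SbT` under all lattice translations, `dipPiece` under block translations -/

section Covariance

variable {I : Type*}

/-- [folklore] An elementary insertion translates: `elemK (p + v) (q + v) m = shiftK (−v) (elemK p q m)`. -/
theorem elemK_translate (p q v : Pt) (m : I → I → ℝ) : elemK (p + v) (q + v) m = shiftK (-v) (elemK p q m) := by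
  funext x z a b
  simp only [shiftK, elemK_apply]
  have e1 : (x = p + v ∧ z = q + v) ↔ (x + -v = p ∧ z + -v = q) := by
    constructor
    · rintro ⟨rfl, rfl⟩; constructor <;> abel
    · rintro ⟨h1, h2⟩; constructor
      · rw [← h1]; abel
      · rw [← h2]; abel
  simp only [e1]

/-- [folklore] **A REALISED LIST TRANSLATES WITH ITS BASE POINT**: `realK (z + v) (z + v) L = shiftK (−v) (realK z z L)`. -/
theorem realK_translate (z v : Pt) (L : Stn I) : realK (z + v) (z + v) L = shiftK (-v) (realK z z L) := by
  induction L with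
  | nil => rfl
  | cons p L ih =>
    rw [realK_cons, realK_cons, shiftK_add', ih, add_right_comm z v p.x, add_right_comm z v p.y, elemK_translate]

/-- [folklore] **THE TRANSVERSE WILSON SECTOR IS TRANSLATION-COVARIANT** (every lattice vector): `SbT κ (u + v) = shiftK (−v) (SbT κ u)`. -/
theorem SbT_translate (κ : Fin 4) (u v : Pt) : SbT κ (u + v) = shiftK (-v) (SbT κ u) := by
  rw [SbT_eq_realK, SbT_eq_realK, realK_translate]

/-- [folklore] In particular `SbT` is block-covariant. -/
theorem SbT_translate_block (n : ℕ) (κ : Fin 4) (u t : Site 4) : SbT κ (u + (n : ℤ) • t) = shiftK (-((n : ℤ) • t)) (SbT κ u) :=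
  SbT_translate κ u _

/-- [folklore] `R∘G′ = G′ − P∘G′` is shift-invariant when `G′` and `P` are. -/
theorem shiftK_RG {G P : MKer 4 Unit} {s : Site 4} (hG : shiftK s G = G) (hP : shiftK s P = P) : shiftK s (RG G P) = RG G P := by
  unfold RProjectorJet.RG
  rw [shiftK_sub', ← comp_shiftK, hG, hP]

variable (n : ℕ) [NeZero n] (a : ℝ)

/-- [folklore] The R-column's source slot translates by a block vector into the row slot: `RG(x, u + n•t) = RG(x − n•t, u)`. -/
theorem RG_translate_source (ha : 0 < a) (x u t : Site 4) :
    RG (Ggh n a) (Pgt n a) x (u + (n : ℤ) • t) () () = RG (Ggh n a) (Pgt n a) (x - (n : ℤ) • t) u () () := by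
  have h := shiftK_RG (shiftK_Ggh n a ha t) (shiftK_Pgt n ha t)
  have h1 := congrFun (congrFun (congrFun (congrFun h (x - (n : ℤ) • t)) u) ()) ()
  rw [← h1]
  simp only [shiftK, sub_add_cancel]

/-- [folklore] The projector's row translates by a block vector into the column: `P(u + n•t, q) = P(u, q − n•t)`. -/
theorem Pgt_translate_row (ha : 0 < a) (u q t : Site 4) :
    Pgt n a (u + (n : ℤ) • t) q () () = Pgt n a u (q - (n : ℤ) • t) () () := by
  have h := shiftK_Pgt n ha t
  have h1 := congrFun (congrFun (congrFun (congrFun h u) (q - (n : ℤ) • t)) ()) ()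
  rw [← h1]
  simp only [shiftK, sub_add_cancel]

/-- [folklore] **THE GHOST-KINETIC DIPOLE PIECE IS BLOCK-COVARIANT**: `dipPiece n a κ (u + n•t) = shiftK (−(n•t)) (dipPiece n a κ u)` (leaf-04-g9's four-tensor
form; each factor translates by `RG_translate_source` ∕ `Pgt_translate_row`; `dSw` commutes with shifts). -/
theorem dipPiece_translate_block (ha : 0 < a) (κ : Fin 4) (u t : Site 4) :
    dipPiece n a κ (u + (n : ℤ) • t) = shiftK (-((n : ℤ) • t)) (dipPiece n a κ u) := by
  rw [dipPiece_eq_dSw_tensor, dipPiece_eq_dSw_tensor, ← dSw_shiftK]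
  congr 1
  funext x z i j
  simp only [shiftK, Pi.add_apply, Pi.sub_apply, Pi.neg_apply, tensor_apply, add_right_comm u ((n : ℤ) • t) (AffineAveraging.unitVec κ),
    RG_translate_source n a ha, Pgt_translate_row n a ha, sub_eq_add_neg]

/-- [folklore] The `V`-corner translates with its vertex when the leg and the projector are shift-invariant. -/
theorem cornerV_shiftK {G P V : MKer 4 Unit} {s : Site 4} (hG : shiftK s G = G) (hP : shiftK s P = P) :
    cornerV G P (shiftK s V) = shiftK s (cornerV G P V) := by
  unfold RProjectorJet.cornerV
  conv_rhs => rw [← comp_shiftK, ← comp_shiftK, shiftK_RG hG hP, hP]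

/-- [folklore] The `Q̇`-corner translates with its vertex when the leg and the projector are shift-invariant. -/
theorem cornerJ_shiftK {G P J : MKer 4 Unit} {s : Site 4} (hG : shiftK s G = G) (hP : shiftK s P = P) :
    cornerJ G P (shiftK s J) = shiftK s (cornerJ G P J) := by
  unfold RProjectorJet.cornerJ
  conv_rhs => rw [← comp_shiftK, shiftK_RG hG hP]

/-- [folklore] **THE PROJECTOR-JET PIECE IS BLOCK-COVARIANT**: `projPiece n a κ (u + n•t) = shiftK (−(n•t)) (projPiece n a κ u)` (`dJetSw_translate` + `shiftK_Pgt`). -/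
theorem projPiece_translate_block (ha : 0 < a) (κ : Fin 4) (u t : Site 4) :
    projPiece n a κ (u + (n : ℤ) • t) = shiftK (-((n : ℤ) • t)) (projPiece n a κ u) := by
  rw [projPiece_apply, projPiece_apply, dJetSw_translate, shiftK_Pgt n ha t]

/-- [folklore] **THE NEEDLE ⊗ COLUMN PIECE IS BLOCK-COVARIANT**: `ndlPiece n a cQ κ (u + n•t) = shiftK (−(n•t)) (ndlPiece n a cQ κ u)` (`qAnti_translate`, `Jq_translate` with
`kerP_translate_road`, the corners' covariance, `dSw_shiftK`). -/
theorem ndlPiece_translate_block (ha : 0 < a) (cQ : ℝ) (κ : Fin 4) (u t : Site 4) :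
    ndlPiece n a cQ κ (u + (n : ℤ) • t) = shiftK (-((n : ℤ) • t)) (ndlPiece n a cQ κ u) := by
  have hG : shiftK (-((n : ℤ) • t)) (Ggh n a) = Ggh n a := by rw [← smul_neg]; exact shiftK_Ggh n a ha (-t)
  have hP : shiftK (-((n : ℤ) • t)) (Pgt n a) = Pgt n a := by rw [← smul_neg]; exact shiftK_Pgt n ha (-t)
  rw [ndlPiece_apply, ndlPiece_apply, qAnti_translate, Jq_translate n a κ u (kerP_translate_road n a ha) t, cornerV_shiftK hG hP, cornerJ_shiftK hG hP,
    ← dSw_shiftK]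
  rfl

end Covariance

end Summit.QuantumFields.BalabanUV.Beta.D1BFx.CellSumTranspose

end
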